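import Mathlib
import HarnessLib
import Literature.MathematicalPhysics.QuantumLattice.HubbardFreeCovariance

/-!
# Route `KLProgramme` — edge facts for the pair masses ACROSS TRANSFERS, XIV: a LOWER COUNT of fermionic Matsubara frequencies in a window,
# `(2k − 1)·π/β ≤ W`, `k ≤ M` ⟹ `2k ≤ #{ν : ω_ν² ≤ W²}` (the frequency half of the layer count behind the pinned floor, `…PinnedFloorCompl` §4)

Cell gate-hubbard-kl, seat hubbard-kl-k3c1-p1 (g21; child-1 lineage).  The tree has UPPER Matsubara counts (`card_filter_matsubaraFreq_le`, Salmhofer (4.63));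
the pinned floor of the complementary members (`klpf_pinned_mass_floor`, `klpf_layer_card_ge`) consumes a LOWER one.  With `ω_ν = π(2n + 1)/β`, `n = ν − M ∈ [−M, M)`,
the `2k` integers `n ∈ [−k, k)` have `|2n + 1| ≤ 2k − 1`, so:

* **`klmw_two_mul_le_card_filter_matsubaraFreq_sq_le`**: `0 < β`, `k ≤ M`, `(2k − 1)·π/β ≤ W` ⟹ `2k ≤ #{ν : MatsubaraIdx M | ω_ν² ≤ W²}`
  (E1 takes `k = ⌊(βW/π + 1)/2⌋`, i.e. `2k ≥ βW/π − 1`; near the thermal scale the window may be empty — those `O(1)` scales go into the `s₀` of the cumulative floor (D3′)).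

Pure counting; no definitions; nothing asserts any slot, stub, K3 or SC. [folklore]
-/

noncomputable section

namespace Summit.HubbardSuperconductivity.HubbardSuperconductivity.Theorems.KLRegimeSplit

set_option linter.dupNamespace false -- summit = problem name (single-conjunct summit), D-0017

open Real Finset Literature.MathematicalPhysics.QuantumLattice Literature.Probability.LatticeModels

/-- The index `M − k + t` (`t < 2k`, `k ≤ M`) is a Matsubara index with integer label `t − k ∈ [−k, k)`. [folklore] -/
theorem klmw_idx_lt {M k t : ℕ} (hk : k ≤ M) (ht : t < 2 * k) : M - k + t < 2 * M := by omega

/-- **Lower Matsubara window count**: `0 < β`, `k ≤ M`, `(2k − 1)·π/β ≤ W` ⟹ `2k ≤ #{ν : ω_ν² ≤ W²}`. [folklore] -/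
theorem klmw_two_mul_le_card_filter_matsubaraFreq_sq_le {M : ℕ} {β : ℝ} (hβ : 0 < β) {k : ℕ} (hk : k ≤ M) {W : ℝ}
    (hW : (2 * (k : ℝ) - 1) * Real.pi / β ≤ W) :
    2 * k ≤ ((univ : Finset (MatsubaraIdx M)).filter fun ν => matsubaraFreq β M ν ^ 2 ≤ W ^ 2).card := by
  classical
  rcases Nat.eq_zero_or_pos k with hk0 | hk0
  · simp [hk0]
  -- the injection `t ↦ M − k + t` from `Fin (2k)`
  let j : Fin (2 * k) → MatsubaraIdx M := fun t => ⟨M - k + t, klmw_idx_lt hk t.2⟩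
  have hj : Function.Injective j := by
    intro t t' h
    have h' : (M - k + (t : ℕ)) = (M - k + (t' : ℕ)) := by
      have := congrArg Fin.val h
      simpa [j] using this
    exact Fin.ext (by omega)
  have hW0 : 0 ≤ W := by
    have h1 : (1 : ℝ) ≤ 2 * (k : ℝ) - 1 := by
      have : (1 : ℝ) ≤ k := by exact_mod_cast hk0
      linarith
    have : 0 ≤ (2 * (k : ℝ) - 1) * Real.pi / β := by positivity
    exact this.trans hW
  have hmem : ∀ t : Fin (2 * k), j t ∈ (univ : Finset (MatsubaraIdx M)).filter fun ν => matsubaraFreq β M ν ^ 2 ≤ W ^ 2 := by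
    intro t
    rw [mem_filter]
    refine ⟨mem_univ _, ?_⟩
    -- the integer label of `j t` is `t − k`
    have hint : (matsubaraInt M (j t) : ℝ) = (t : ℝ) - k := by
      simp only [matsubaraInt, j]
      push_cast [Nat.cast_sub hk]
      ring
    have habs : |2 * ((t : ℝ) - k) + 1| ≤ 2 * (k : ℝ) - 1 := by
      have ht : ((t : ℕ) : ℝ) < 2 * k := by exact_mod_cast t.2
      have ht0 : (0 : ℝ) ≤ (t : ℕ) := Nat.cast_nonneg _
      rw [abs_le]
      constructor
      · linarith
      · -- `t ≤ 2k − 1`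
        have : ((t : ℕ) : ℝ) ≤ 2 * k - 1 := by
          have h2 : (t : ℕ) + 1 ≤ 2 * k := t.2
          have : (((t : ℕ) + 1 : ℕ) : ℝ) ≤ ((2 * k : ℕ) : ℝ) := by exact_mod_cast h2
          push_cast at this
          linarith
        linarith
    have hω : |matsubaraFreq β M (j t)| ≤ W := by
      rw [matsubaraFreq, hint, abs_div, abs_of_pos hβ, abs_mul, abs_of_pos Real.pi_pos]
      calc Real.pi * |2 * ((t : ℝ) - k) + 1| / β ≤ Real.pi * (2 * (k : ℝ) - 1) / β :=
            div_le_div_of_nonneg_right (mul_le_mul_of_nonneg_left habs Real.pi_pos.le) hβ.le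
        _ = (2 * (k : ℝ) - 1) * Real.pi / β := by ring
        _ ≤ W := hW
    exact sq_le_sq' (by linarith [neg_abs_le (matsubaraFreq β M (j t))]) ((le_abs_self _).trans hω)
  calc 2 * k = (univ : Finset (Fin (2 * k))).card := by simp
    _ = ((univ : Finset (Fin (2 * k))).image j).card := (Finset.card_image_of_injective _ hj).symm
    _ ≤ _ := Finset.card_le_card fun ν hν => by
        obtain ⟨t, -, rfl⟩ := Finset.mem_image.1 hν
        exact hmem t

end Summit.HubbardSuperconductivity.HubbardSuperconductivity.Theorems.KLRegimeSplit

end
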